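import Mathlib
import HarnessLib

/-!
# Convolution powers, the Green series, the maximum principle and `κ = 0`

Helper file for item `stmt-CriticalPhenomena-4804`
(`Summit.CriticalPhenomena.Ising3DConformalLimit.Theses.PrecisionLaplacian.EtaBoundsTransfer`), part of its
unconditional proof: potential theory of inverse M-matrices ⇒ infinite-volume equation and Green-function
representation; Fourier analysis on `[-π,π]^d` ⇒ block-sum upper bounds; quadratic test function ⇒ ball-sum
lower bounds; Messager–Miracle-Solé ⇒ pointwise two-sided power bounds. No definitions are introduced: the
objects (kernel matrices, box sequences, convolution powers) enter through defining hypotheses.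
-/

namespace Summit.CriticalPhenomena.Ising3DConformalLimit.Theorems.EtaBoundsTransfer

open Finset Filter Topology
open scoped ENNReal NNReal

section Green

variable {X : Type*} [AddCommGroup X] [DecidableEq X]
  {G : X → ℝ} {b : X → ℝ} {A₀ : ℝ} {Q : ℕ → X → ℝ≥0∞}

omit [DecidableEq X] in
/-- Translation invariance of `tsum` over the group: `∑' z, f (z - y) = ∑' z, f z`. -/
theorem tsum_sub_right {M : Type*} [AddCommMonoid M] [TopologicalSpace M] (f : X → M) (y : X) :
    ∑' z, f (z - y) = ∑' z, f z :=
  (Equiv.subRight y).tsum_eq f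

/-- **Total mass of the convolution powers**: `∑_z Q n z = ρ^n` with `ρ = ∑_y q y`,
`q = b / A₀`. -/
theorem tsum_Q_eq_pow (hb0 : ∀ y, 0 ≤ b y) (hbs : Summable b) (hA0 : 0 < A₀)
    (hQ0 : ∀ z, Q 0 z = if z = 0 then 1 else 0)
    (hQs : ∀ n z, Q (n + 1) z = ∑' y, ENNReal.ofReal (b y / A₀) * Q n (z - y)) (n : ℕ) :
    ∑' z, Q n z = (ENNReal.ofReal ((∑' y, b y) / A₀)) ^ n := by
  have hρ : ENNReal.ofReal ((∑' y, b y) / A₀) = ∑' y, ENNReal.ofReal (b y / A₀) := by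
    rw [show (∑' y, b y) / A₀ = ∑' y, b y / A₀ from (tsum_div_const ..).symm]
    exact ENNReal.ofReal_tsum_of_nonneg (fun y => div_nonneg (hb0 y) hA0.le) (hbs.div_const A₀)
  induction n with
  | zero =>
    simp only [hQ0, pow_zero]
    rw [tsum_ite_eq]
  | succ n ih =>
    simp only [hQs]
    rw [ENNReal.tsum_comm]
    simp_rw [ENNReal.tsum_mul_left]
    have h1 : ∀ y, ∑' z, Q n (z - y) = (ENNReal.ofReal ((∑' y, b y) / A₀)) ^ n := by
      intro y; rw [tsum_sub_right (Q n) y, ih]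
    simp_rw [h1]
    rw [ENNReal.tsum_mul_right, ← hρ, pow_succ, mul_comm]

omit [AddCommGroup X] [DecidableEq X] in
/-- The mass `ρ = (∑ b)/A₀` is at most `1` when `∑ b ≤ A₀`. -/
theorem rho_le_one (hA0 : 0 < A₀) (hbA : ∑' y, b y ≤ A₀) :
    ENNReal.ofReal ((∑' y, b y) / A₀) ≤ 1 := by
  rw [← ENNReal.ofReal_one]
  exact ENNReal.ofReal_le_ofReal ((div_le_one hA0).2 hbA)

/-- Each convolution power is pointwise at most `1`. -/
theorem Q_le_one (hb0 : ∀ y, 0 ≤ b y) (hbs : Summable b) (hA0 : 0 < A₀) (hbA : ∑' y, b y ≤ A₀)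
    (hQ0 : ∀ z, Q 0 z = if z = 0 then 1 else 0)
    (hQs : ∀ n z, Q (n + 1) z = ∑' y, ENNReal.ofReal (b y / A₀) * Q n (z - y)) (n : ℕ) (z : X) :
    Q n z ≤ 1 := by
  calc Q n z ≤ ∑' z, Q n z := ENNReal.le_tsum z
    _ = (ENNReal.ofReal ((∑' y, b y) / A₀)) ^ n := tsum_Q_eq_pow hb0 hbs hA0 hQ0 hQs n
    _ ≤ 1 := pow_le_one' (rho_le_one hA0 hbA) n

/-- The equation `A₀ G = δ + b ∗ G` in `ℝ≥0∞` form, divided by `A₀`: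
`G(z) = A₀⁻¹ δ_{z0} + ∑_y q(y) G(z−y)`. -/
theorem ennreal_equation (hG0 : ∀ x, 0 ≤ G x) (hGle : ∀ x, G x ≤ G 0) (hb0 : ∀ y, 0 ≤ b y)
    (hbs : Summable b) (hA0 : 0 < A₀)
    (heq : ∀ z, A₀ * G z - ∑' y, b y * G (z - y) = if z = 0 then 1 else 0) (z : X) :
    ENNReal.ofReal (G z) = (ENNReal.ofReal A₀)⁻¹ * (if z = 0 then 1 else 0)
      + ∑' y, ENNReal.ofReal (b y / A₀) * ENNReal.ofReal (G (z - y)) := by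
  have hsumm : Summable (fun y => b y * G (z - y)) :=
    Summable.of_nonneg_of_le (fun y => mul_nonneg (hb0 y) (hG0 _))
      (fun y => mul_le_mul_of_nonneg_left (hGle _) (hb0 y)) (hbs.mul_right (G 0))
  have h1 : G z = A₀⁻¹ * (if z = 0 then 1 else 0) + ∑' y, (b y / A₀) * G (z - y) := by
    have := heq z
    have h2 : ∑' y, (b y / A₀) * G (z - y) = A₀⁻¹ * ∑' y, b y * G (z - y) := by
      rw [← tsum_mul_left]; congr 1; funext y; field_simp
    rw [h2, ← this]
    field_simp
    ring
  have hδ : (0:ℝ) ≤ (if z = 0 then 1 else 0) := by split_ifs <;> norm_num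
  have htn : 0 ≤ ∑' y, (b y / A₀) * G (z - y) :=
    tsum_nonneg fun y => mul_nonneg (div_nonneg (hb0 y) hA0.le) (hG0 _)
  rw [h1, ENNReal.ofReal_add (mul_nonneg (inv_nonneg.2 hA0.le) hδ) htn,
    ENNReal.ofReal_mul (inv_nonneg.2 hA0.le), ENNReal.ofReal_inv_of_pos hA0]
  congr 1
  · congr 1; split_ifs <;> simp
  · rw [ENNReal.ofReal_tsum_of_nonneg (fun y => mul_nonneg (div_nonneg (hb0 y) hA0.le) (hG0 _))
      (by simpa [div_eq_mul_inv, mul_comm, mul_assoc, mul_left_comm] using (hsumm.mul_left A₀⁻¹))]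
    congr 1; funext y
    rw [ENNReal.ofReal_mul (div_nonneg (hb0 y) hA0.le)]

/-- **Partial Green sums are dominated by `G`**: `A₀⁻¹ ∑_{n<N} Q n z ≤ G z` (induction on `N`,
using `G = A₀⁻¹δ + q ∗ G ≥ A₀⁻¹δ + q ∗ (partial sum)`). -/
theorem partial_green_le (hG0 : ∀ x, 0 ≤ G x) (hGle : ∀ x, G x ≤ G 0) (hb0 : ∀ y, 0 ≤ b y)
    (hbs : Summable b) (hA0 : 0 < A₀)
    (heq : ∀ z, A₀ * G z - ∑' y, b y * G (z - y) = if z = 0 then 1 else 0)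
    (hQ0 : ∀ z, Q 0 z = if z = 0 then 1 else 0)
    (hQs : ∀ n z, Q (n + 1) z = ∑' y, ENNReal.ofReal (b y / A₀) * Q n (z - y)) (N : ℕ) (z : X) :
    (ENNReal.ofReal A₀)⁻¹ * ∑ n ∈ Finset.range N, Q n z ≤ ENNReal.ofReal (G z) := by
  induction N generalizing z with
  | zero => simp
  | succ N ih =>
    rw [Finset.sum_range_succ', hQ0]
    simp only [hQs]
    rw [ennreal_equation hG0 hGle hb0 hbs hA0 heq z, mul_add, add_comm]
    gcongr
    -- `A₀⁻¹ ∑_{n<N} ∑_y q y Q n (z-y) = ∑_y q y (A₀⁻¹ ∑_{n<N} Q n (z - y)) ≤ ∑_y q y G(z-y)`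
    rw [← Summable.tsum_finsetSum (fun _ _ => ENNReal.summable), ← ENNReal.tsum_mul_left]
    refine ENNReal.tsum_le_tsum fun y => ?_
    rw [← Finset.mul_sum, ← mul_assoc, mul_comm ((ENNReal.ofReal A₀)⁻¹), mul_assoc]
    exact mul_le_mul' le_rfl (ih (z - y))

/-- **The Green series is dominated by `G`**: `A₀⁻¹ ∑_n Q n z ≤ G z`; in particular the series
is finite. -/
theorem green_le (hG0 : ∀ x, 0 ≤ G x) (hGle : ∀ x, G x ≤ G 0) (hb0 : ∀ y, 0 ≤ b y)
    (hbs : Summable b) (hA0 : 0 < A₀)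
    (heq : ∀ z, A₀ * G z - ∑' y, b y * G (z - y) = if z = 0 then 1 else 0)
    (hQ0 : ∀ z, Q 0 z = if z = 0 then 1 else 0)
    (hQs : ∀ n z, Q (n + 1) z = ∑' y, ENNReal.ofReal (b y / A₀) * Q n (z - y)) (z : X) :
    (ENNReal.ofReal A₀)⁻¹ * ∑' n, Q n z ≤ ENNReal.ofReal (G z) := by
  rw [ENNReal.tsum_eq_iSup_nat, ENNReal.mul_iSup]
  exact iSup_le fun N => partial_green_le hG0 hGle hb0 hbs hA0 heq hQ0 hQs N z

/-- The Green series `∑_n Q n z` is finite. -/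
theorem tsum_Q_ne_top (hG0 : ∀ x, 0 ≤ G x) (hGle : ∀ x, G x ≤ G 0) (hb0 : ∀ y, 0 ≤ b y)
    (hbs : Summable b) (hA0 : 0 < A₀)
    (heq : ∀ z, A₀ * G z - ∑' y, b y * G (z - y) = if z = 0 then 1 else 0)
    (hQ0 : ∀ z, Q 0 z = if z = 0 then 1 else 0)
    (hQs : ∀ n z, Q (n + 1) z = ∑' y, ENNReal.ofReal (b y / A₀) * Q n (z - y)) (z : X) :
    ∑' n, Q n z ≠ ∞ := by
  have h := green_le hG0 hGle hb0 hbs hA0 heq hQ0 hQs z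
  intro htop
  rw [htop, ENNReal.mul_top (ENNReal.inv_ne_zero.2 ENNReal.ofReal_ne_top)] at h
  exact absurd h (by simp)

/-- **The Green series solves the same equation**: with `v z = A₀⁻¹ ∑_n Q n z`,
`v(z) = A₀⁻¹ δ_{z0} + ∑_y q(y) v(z − y)`. -/
theorem green_equation (hA0 : 0 < A₀)
    (hQ0 : ∀ z, Q 0 z = if z = 0 then 1 else 0)
    (hQs : ∀ n z, Q (n + 1) z = ∑' y, ENNReal.ofReal (b y / A₀) * Q n (z - y)) (z : X) :
    (ENNReal.ofReal A₀)⁻¹ * ∑' n, Q n z = (ENNReal.ofReal A₀)⁻¹ * (if z = 0 then 1 else 0)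
      + ∑' y, ENNReal.ofReal (b y / A₀) * ((ENNReal.ofReal A₀)⁻¹ * ∑' n, Q n (z - y)) := by
  have _ := hA0
  rw [tsum_eq_zero_add' ENNReal.summable, hQ0, mul_add]
  congr 1
  simp only [hQs]
  rw [ENNReal.tsum_comm]
  simp_rw [ENNReal.tsum_mul_left]
  rw [← ENNReal.tsum_mul_left]
  refine tsum_congr fun y => ?_
  ring

end Green

end Summit.CriticalPhenomena.Ising3DConformalLimit.Theorems.EtaBoundsTransfer

namespace Summit.CriticalPhenomena.Ising3DConformalLimit.Theorems.EtaBoundsTransfer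

open Finset Filter Topology
open scoped ENNReal NNReal

section Green2

variable {X : Type*} [AddCommGroup X] [DecidableEq X]
  {G : X → ℝ} {b : X → ℝ} {A₀ : ℝ} {Q : ℕ → X → ℝ≥0∞}

/-- The equation `A₀ G = δ + b ∗ G` in real form, divided by `A₀`. -/
theorem real_equation (hG0 : ∀ x, 0 ≤ G x) (hGle : ∀ x, G x ≤ G 0) (hb0 : ∀ y, 0 ≤ b y)
    (hbs : Summable b) (hA0 : 0 < A₀)
    (heq : ∀ z, A₀ * G z - ∑' y, b y * G (z - y) = if z = 0 then 1 else 0) (z : X) :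
    G z = A₀⁻¹ * (if z = 0 then 1 else 0) + ∑' y, (b y / A₀) * G (z - y) := by
  have _ : Summable (fun y => b y * G (z - y)) :=
    Summable.of_nonneg_of_le (fun y => mul_nonneg (hb0 y) (hG0 _))
      (fun y => mul_le_mul_of_nonneg_left (hGle _) (hb0 y)) (hbs.mul_right (G 0))
  have := heq z
  have h2 : ∑' y, (b y / A₀) * G (z - y) = A₀⁻¹ * ∑' y, b y * G (z - y) := by
    rw [← tsum_mul_left]; congr 1; funext y; field_simp
  rw [h2, ← this]
  field_simp
  ring

omit [DecidableEq X] in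
/-- Summability of `y ↦ q(y) G(z − y)`. -/
theorem summable_q_mul (hG0 : ∀ x, 0 ≤ G x) (hGle : ∀ x, G x ≤ G 0) (hb0 : ∀ y, 0 ≤ b y)
    (hbs : Summable b) (hA0 : 0 < A₀) (z : X) :
    Summable (fun y => (b y / A₀) * G (z - y)) :=
  Summable.of_nonneg_of_le (fun y => mul_nonneg (div_nonneg (hb0 y) hA0.le) (hG0 _))
    (fun y => mul_le_mul_of_nonneg_left (hGle _) (div_nonneg (hb0 y) hA0.le))
    ((hbs.div_const A₀).mul_right (G 0))

/-- **Real form of the Green-series equation**: with `vr z = (A₀⁻¹ ∑_n Q n z).toReal`,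
`vr(z) = A₀⁻¹ δ_{z0} + ∑_y q(y) vr(z − y)`. -/
theorem green_equation_real (hG0 : ∀ x, 0 ≤ G x) (hGle : ∀ x, G x ≤ G 0) (hb0 : ∀ y, 0 ≤ b y)
    (hbs : Summable b) (hA0 : 0 < A₀)
    (heq : ∀ z, A₀ * G z - ∑' y, b y * G (z - y) = if z = 0 then 1 else 0)
    (hQ0 : ∀ z, Q 0 z = if z = 0 then 1 else 0)
    (hQs : ∀ n z, Q (n + 1) z = ∑' y, ENNReal.ofReal (b y / A₀) * Q n (z - y)) (z : X) :
    ((ENNReal.ofReal A₀)⁻¹ * ∑' n, Q n z).toReal = A₀⁻¹ * (if z = 0 then 1 else 0)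
      + ∑' y, (b y / A₀) * ((ENNReal.ofReal A₀)⁻¹ * ∑' n, Q n (z - y)).toReal := by
  have hfin : ∀ w, (ENNReal.ofReal A₀)⁻¹ * ∑' n, Q n w ≠ ∞ := fun w =>
    ne_top_of_le_ne_top ENNReal.ofReal_ne_top (green_le hG0 hGle hb0 hbs hA0 heq hQ0 hQs w)
  rw [green_equation hA0 hQ0 hQs z]
  have h1 : (ENNReal.ofReal A₀)⁻¹ * (if z = 0 then 1 else 0) ≠ ∞ :=
    ENNReal.mul_ne_top (ENNReal.inv_ne_top.2 (by simp [hA0])) (by split_ifs <;> simp)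
  have hterm : ∀ y, ENNReal.ofReal (b y / A₀) * ((ENNReal.ofReal A₀)⁻¹ * ∑' n, Q n (z - y)) ≠ ∞ :=
    fun y => ENNReal.mul_ne_top ENNReal.ofReal_ne_top (hfin _)
  have h2 : ∑' y, ENNReal.ofReal (b y / A₀) * ((ENNReal.ofReal A₀)⁻¹ * ∑' n, Q n (z - y)) ≠ ∞ := by
    have := hfin z
    rw [green_equation hA0 hQ0 hQs z] at this
    exact (ENNReal.add_ne_top.1 this).2
  rw [ENNReal.toReal_add h1 h2, ENNReal.toReal_mul, ENNReal.toReal_inv,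
    ENNReal.toReal_ofReal hA0.le, ENNReal.tsum_toReal_eq hterm]
  congr 1
  · congr 1; split_ifs <;> simp
  · refine tsum_congr fun y => ?_
    rw [ENNReal.toReal_mul, ENNReal.toReal_ofReal (div_nonneg (hb0 y) hA0.le)]

omit [DecidableEq X] in
/-- **Maximum principle**: a nonnegative `q`-harmonic function tending to `0` at infinity
vanishes, when `q > 0` off the origin and `∑ q ≤ 1`. -/
theorem harmonic_eq_zero [Infinite X] {h q : X → ℝ} (hq0 : ∀ y, 0 ≤ q y)
    (hqpos : ∀ y, y ≠ 0 → 0 < q y) (hqs : Summable q) (hq1 : ∑' y, q y ≤ 1)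
    (hh0 : ∀ z, 0 ≤ h z) (hhto : Tendsto h cofinite (𝓝 0))
    (hsum : ∀ z, Summable (fun y => q y * h (z - y)))
    (hharm : ∀ z, h z = ∑' y, q y * h (z - y)) : ∀ z, h z = 0 := by
  by_contra hne
  push Not at hne
  obtain ⟨x₁, hx₁⟩ := hne
  have hx₁pos : 0 < h x₁ := lt_of_le_of_ne (hh0 x₁) (Ne.symm hx₁)
  -- the finite set where `h ≥ h x₁`
  have hfin : {z | h x₁ ≤ h z}.Finite := by
    have hev : ∀ᶠ z in cofinite, h z < h x₁ := hhto.eventually (gt_mem_nhds hx₁pos)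
    have := Filter.eventually_cofinite.1 hev
    simpa [not_lt] using this
  have hx₁F : x₁ ∈ hfin.toFinset := hfin.mem_toFinset.2 (show h x₁ ≤ h x₁ from le_rfl)
  obtain ⟨x₀, hx₀F, hmax⟩ := Finset.exists_max_image hfin.toFinset h ⟨x₁, hx₁F⟩
  have hx₀ge : h x₁ ≤ h x₀ := hfin.mem_toFinset.1 hx₀F
  have hle : ∀ z, h z ≤ h x₀ := by
    intro z
    by_cases hz : h x₁ ≤ h z
    · exact hmax z (hfin.mem_toFinset.2 hz)
    · exact (le_of_lt (not_le.1 hz)).trans hx₀ge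
  -- `∑ q(y) (h x₀ - h(x₀ - y)) = 0` with nonnegative terms
  have hdiff_summ : Summable (fun y => q y * (h x₀ - h (x₀ - y))) := by
    have : (fun y => q y * (h x₀ - h (x₀ - y))) = fun y => q y * h x₀ - q y * h (x₀ - y) := by
      funext y; ring
    rw [this]
    exact (hqs.mul_right _).sub (hsum x₀)
  have hdiff_nn : ∀ y, 0 ≤ q y * (h x₀ - h (x₀ - y)) :=
    fun y => mul_nonneg (hq0 y) (by linarith [hle (x₀ - y)])
  have hdiff_le : ∑' y, q y * (h x₀ - h (x₀ - y)) ≤ 0 := by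
    have h1 : ∑' y, q y * (h x₀ - h (x₀ - y)) = (∑' y, q y) * h x₀ - h x₀ := by
      rw [show (fun y => q y * (h x₀ - h (x₀ - y))) = fun y => q y * h x₀ - q y * h (x₀ - y) from
        funext fun y => by ring]
      rw [(hqs.mul_right _).tsum_sub (hsum x₀), tsum_mul_right, ← hharm x₀]
    rw [h1]
    nlinarith [hh0 x₀]
  have hzero : (fun y => q y * (h x₀ - h (x₀ - y))) = 0 := by
    have h0 : ∑' y, q y * (h x₀ - h (x₀ - y)) = 0 := le_antisymm hdiff_le (tsum_nonneg hdiff_nn)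
    have := hdiff_summ.hasSum
    rw [h0] at this
    exact (hasSum_zero_iff_of_nonneg hdiff_nn).1 this
  have hconst : ∀ y, y ≠ 0 → h (x₀ - y) = h x₀ := by
    intro y hy
    have := congr_fun hzero y
    simp only [Pi.zero_apply, mul_eq_zero] at this
    rcases this with h1 | h1
    · exact absurd h1 (hqpos y hy).ne'
    · linarith
  -- a point where `h < h x₁`
  obtain ⟨z, hz⟩ : ∃ z, h z < h x₁ := (hhto.eventually (gt_mem_nhds hx₁pos)).exists
  have hyz : x₀ - z ≠ 0 := by
    intro h0
    have : z = x₀ := by rw [sub_eq_zero] at h0; exact h0.symm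
    rw [this] at hz
    linarith
  have := hconst (x₀ - z) hyz
  rw [sub_sub_cancel] at this
  linarith

/-- **Green-function representation** `G(z) = A₀⁻¹ ∑_n Q n z` (in `ℝ≥0∞`): the difference
`G − v` is a nonnegative `q`-harmonic function tending to `0`, hence vanishes. -/
theorem green_repr [Infinite X] (hG0 : ∀ x, 0 ≤ G x) (hGle : ∀ x, G x ≤ G 0)
    (hGto : Tendsto G cofinite (𝓝 0)) (hb0 : ∀ y, 0 ≤ b y) (hbpos : ∀ y, y ≠ 0 → 0 < b y)
    (hbs : Summable b) (hA0 : 0 < A₀) (hbA : ∑' y, b y ≤ A₀)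
    (heq : ∀ z, A₀ * G z - ∑' y, b y * G (z - y) = if z = 0 then 1 else 0)
    (hQ0 : ∀ z, Q 0 z = if z = 0 then 1 else 0)
    (hQs : ∀ n z, Q (n + 1) z = ∑' y, ENNReal.ofReal (b y / A₀) * Q n (z - y)) (z : X) :
    ENNReal.ofReal (G z) = (ENNReal.ofReal A₀)⁻¹ * ∑' n, Q n z := by
  set v : X → ℝ≥0∞ := fun w => (ENNReal.ofReal A₀)⁻¹ * ∑' n, Q n w with hv
  have hvle : ∀ w, v w ≤ ENNReal.ofReal (G w) := fun w => green_le hG0 hGle hb0 hbs hA0 heq hQ0 hQs w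
  have hvfin : ∀ w, v w ≠ ∞ := fun w => ne_top_of_le_ne_top ENNReal.ofReal_ne_top (hvle w)
  set vr : X → ℝ := fun w => (v w).toReal with hvr
  have hvr_le : ∀ w, vr w ≤ G w := fun w => ENNReal.toReal_le_of_le_ofReal (hG0 w) (hvle w)
  have hvr_nn : ∀ w, 0 ≤ vr w := fun w => ENNReal.toReal_nonneg
  set hr : X → ℝ := fun w => G w - vr w with hhr
  -- `hr` is `q`-harmonic
  have hq0 : ∀ y, 0 ≤ b y / A₀ := fun y => div_nonneg (hb0 y) hA0.le
  have hsumG := summable_q_mul hG0 hGle hb0 hbs hA0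
  have hsumv : ∀ w, Summable (fun y => (b y / A₀) * vr (w - y)) := fun w =>
    Summable.of_nonneg_of_le (fun y => mul_nonneg (hq0 y) (hvr_nn _))
      (fun y => mul_le_mul_of_nonneg_left (hvr_le _) (hq0 y)) (hsumG w)
  have hsumh : ∀ w, Summable (fun y => (b y / A₀) * hr (w - y)) := by
    intro w
    have : (fun y => (b y / A₀) * hr (w - y)) = fun y => (b y / A₀) * G (w - y) - (b y / A₀) * vr (w - y) := by
      funext y; simp only [hhr]; ring
    rw [this]; exact (hsumG w).sub (hsumv w)
  have hharm : ∀ w, hr w = ∑' y, (b y / A₀) * hr (w - y) := by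
    intro w
    have e1 := real_equation hG0 hGle hb0 hbs hA0 heq w
    have e2 := green_equation_real hG0 hGle hb0 hbs hA0 heq hQ0 hQs w
    have : (fun y => (b y / A₀) * hr (w - y)) = fun y => (b y / A₀) * G (w - y) - (b y / A₀) * vr (w - y) := by
      funext y; simp only [hhr]; ring
    rw [this, (hsumG w).tsum_sub (hsumv w)]
    simp only [hhr, hvr, hv]
    rw [e2]
    linarith [e1]
  have hhto : Tendsto hr cofinite (𝓝 0) := by
    apply tendsto_of_tendsto_of_tendsto_of_le_of_le tendsto_const_nhds hGto
    · intro w; simp only [hhr]; linarith [hvr_le w]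
    · intro w; simp only [hhr]; linarith [hvr_nn w]
  have hq1 : ∑' y, b y / A₀ ≤ 1 := by
    rw [tsum_div_const]; exact (div_le_one hA0).2 hbA
  have hzero := harmonic_eq_zero hq0 (fun y hy => div_pos (hbpos y hy) hA0) (hbs.div_const A₀) hq1
    (fun w => by simp only [hhr]; linarith [hvr_le w]) hhto hsumh hharm z
  have hGv : G z = vr z := by simp only [hhr] at hzero; linarith
  rw [hGv, hvr]
  exact ENNReal.ofReal_toReal (hvfin z)

/-- **No killing at criticality** (`κ = 0`): if `G` is not summable then `∑ b = A₀`, i.e. the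
step law `q = b / A₀` is a probability (otherwise the Green series has finite total mass
`A₀⁻¹ (1 − ρ)⁻¹`). -/
theorem tsum_b_eq [Infinite X] (hG0 : ∀ x, 0 ≤ G x) (hGle : ∀ x, G x ≤ G 0)
    (hGto : Tendsto G cofinite (𝓝 0)) (hGns : ¬ Summable G)
    (hb0 : ∀ y, 0 ≤ b y) (hbpos : ∀ y, y ≠ 0 → 0 < b y)
    (hbs : Summable b) (hA0 : 0 < A₀) (hbA : ∑' y, b y ≤ A₀)
    (heq : ∀ z, A₀ * G z - ∑' y, b y * G (z - y) = if z = 0 then 1 else 0)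
    (hQ0 : ∀ z, Q 0 z = if z = 0 then 1 else 0)
    (hQs : ∀ n z, Q (n + 1) z = ∑' y, ENNReal.ofReal (b y / A₀) * Q n (z - y)) :
    ∑' y, b y = A₀ := by
  by_contra hne
  have hlt : ∑' y, b y < A₀ := lt_of_le_of_ne hbA hne
  set ρ := ENNReal.ofReal ((∑' y, b y) / A₀) with hρ
  have hρ1 : ρ < 1 := by
    rw [hρ, ← ENNReal.ofReal_one]
    exact (ENNReal.ofReal_lt_ofReal_iff zero_lt_one).2 ((div_lt_one hA0).2 hlt)
  have htot : ∑' z, ENNReal.ofReal (G z) = (ENNReal.ofReal A₀)⁻¹ * (1 - ρ)⁻¹ := by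
    simp_rw [green_repr hG0 hGle hGto hb0 hbpos hbs hA0 hbA heq hQ0 hQs]
    rw [ENNReal.tsum_mul_left, ENNReal.tsum_comm]
    simp_rw [tsum_Q_eq_pow hb0 hbs hA0 hQ0 hQs]
    rw [ENNReal.tsum_geometric]
  have hfin : ∑' z, ENNReal.ofReal (G z) ≠ ∞ := by
    rw [htot]
    exact ENNReal.mul_ne_top (ENNReal.inv_ne_top.2 (by simp [hA0]))
      (ENNReal.inv_ne_top.2 (tsub_pos_of_lt hρ1).ne')
  apply hGns
  have hs := ENNReal.summable_toReal hfin
  refine hs.congr fun z => ?_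
  exact ENNReal.toReal_ofReal (hG0 z)

end Green2

end Summit.CriticalPhenomena.Ising3DConformalLimit.Theorems.EtaBoundsTransfer
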